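import Summits.HodgeConjecture.CorCM.GaloisFourSemidirectFourTimesCyclicDegenerate
import HarnessLib

/-!
# `(C₄ ⋊ C₄) × C_n` (`n ≥ 3`) is BAD for EVERY complex conjugation in the `C₄ ⋊ C₄` factor: the third involution `c = y²`

COR-CM (cell `pub-hodgecm2`), binder seat b04 (gen 30), count-neutral own lane «Galois-CM-type classification» (which Galois CM
fields `(G, c)` have ALL primitive CM types nondegenerate = GOOD, vs. a primitive degenerate type = BAD).  KERNEL ONLY: theorems;
no definition, no named fact, no `sorry`.  `HC_CM` is neither used nor claimed.

SETTING.  `C₄ ⋊ C₄ = ⟨x⟩ ⋊ ⟨y⟩` (`y x y⁻¹ = x⁻¹`), presented as `Multiplicative (ZMod 4) ⋊[φ] Multiplicative (ZMod 4)` with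
`φ(1) = (·)⁻¹` (`inl` = `⟨x⟩`, `inr` = `⟨y⟩`).  Its centre is `⟨x², y²⟩ ≅ C₂²`, so a Galois CM field with this group has complex
conjugation `c ∈ {x², x²y², y²}`.  `CorCM/GaloisFourSemidirectFourTimesCyclicDegenerate` settles `c ∈ {x², x²y²}` with the abelian
index-two subgroup `A = ⟨x⟩ × ⟨y²⟩` and `z = y` (`z² = y²`, and `c ∉ ⟨y²⟩` exactly for those two).  For the THIRD involution `c = y²`
(`= z²` for every `z ∉ A`, so `A` is useless) we use the OTHER abelian subgroup of index two containing the centre: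
`A' = ⟨y⟩ × ⟨x²⟩ ≅ ℤ/4 × ℤ/2` (coordinates `(t, s) ↔ x^{2s} yᵗ`), `z = x ∉ A'`, `z² = x² = q ↔ (0, 1)`, and
`θ' = conj_x` acts by `x y x⁻¹ = x² y`, i.e. **`θ'(t, s) = (t, s + t mod 2)`**; now `c = y² ↔ (2, 0) ∉ ⟨q⟩ = {(0,0), (0,1)}`, so the
INDEX-TWO CRITERION `CorCM/GaloisIndexTwoDoubledTypes.exists_simple_degenerate_of_index_two_doubled` applies.
* §1 `exists_simple_degenerate_fourSemidirectFour_times_cyclic_ySq_of_half`: `Gal(K/ℚ) ≅ (C₄ ⋊ C₄) × C_n`, `c = (y², 1)`, plus an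
  aperiodic `θ'`-asymmetric CM half of `(ℤ/4 × ℤ/2) × ℤ/n` (decidable predicate) ⟹ BAD (simple degenerate CM `8n`-fold).  The only
  group theory needed is `φ(yᵗ)(x) = x^{∓1}` (`t` odd/even), from `φ(y) = (·)⁻¹`; every identity in `C₄ ⋊ C₄` is then a `decide`
  in `ℤ/4`.
* §2 ALL DEGREES `n ≥ 3` by the two-halves fibre construction of `CorCM/GaloisTwoHalvesCyclicFibres` with the pair of halves
  `H₁ = {(0,0),(0,1),(1,0),(1,1)}`, `H₂ = {(0,1),(1,1),(2,0),(3,0)}` of `(ℤ/4 × ℤ/2, c = (2,0))` (no common stabiliser, no common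
  `θ'`-reflection; `decide` inside `ℤ/4 × ℤ/2`): **`(C₄ ⋊ C₄) × C_n` with `c = y²` is BAD for every `n ≥ 3`**.
* §3 THE COMPLETE STATEMENT `exists_simple_degenerate_fourSemidirectFour_times_cyclic_all`: **for every `n ≥ 3` and EACH of the
  three central involutions `x², x²y², y²` as complex conjugation, a Galois CM field with group `(C₄ ⋊ C₄) × C_n` carries a SIMPLE
  DEGENERATE abelian variety of dimension `8n`** (with an exceptional Hodge class on some power).  With this file every
  non-abelian group `Γ` of order 16 other than the generalised quaternion group `Q₁₆` and `Q₈ × C₂` with `c = a²` (the HARD,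
  arithmetic side: `c ∈ ⟨z²⟩` for every `z` outside every abelian index-two subgroup) gives BAD `Γ × C_n` for all `n ≥ 3` in the
  tree (`D₄ × C₂`, `Q₈ × C₂` with `c` off the core: gens 19/24; `D₈, SD₁₆, M₁₆, Pauli, (C₄×C₂)⋊C₂`: gen 29; `C₄ ⋊ C₄`: gens 29–30).

## References

* [Kubota1965] T. Kubota, *On the field extension by complex multiplication*, Trans. AMS 118 (1965), §2, §4 Lemma 2.
* [Shimura1998] G. Shimura, *Abelian Varieties with Complex Multiplication and Modular Functions*, §6.2 Thm. 3, §8.2 Prop. 26.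
* [Gordon1999HodgeAVSurvey] B. B. Gordon, *A survey of the Hodge conjecture for abelian varieties*, Thm. 6.4, §9.3.
-/

noncomputable section

open CategoryTheory CategoryTheory.Limits NumberField
open scoped BigOperators

namespace Summit.HodgeConjecture.CorCM.SplitInvolution

open Literature.NumberTheory.ComplexMultiplication
open Literature.AlgebraicGeometry.Motives (AbelianVariety CMType)
open Literature.AlgebraicGeometry.HodgeTheory
open Literature.AlgebraicGeometry.ComplexMultiplication (IsCMTypeRealisation)
open Literature.AlgebraicGeometry.Pohlmann1968
open Literature.Barriers.HodgeConjecture (divisorClassesSpan)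

/-! ## §1 The doubled type over `A' = ⟨y⟩ × ⟨x²⟩`, `z = x`, for `c = y²` -/

section Field

variable {K : Type} [Field K] [NumberField K] [IsCMField K] [IsGalois ℚ K]

/-- **`Gal(K/ℚ) ≅ (C₄ ⋊ C₄) × C_n`** (`φ(1) = (·)⁻¹`), complex conjugation `c = (y², 1)`, with an aperiodic `θ'`-asymmetric CM half of
`(ℤ/4 × ℤ/2) × ℤ/n` (`A' = ⟨y⟩ × ⟨x²⟩`, `(t,s) ↔ x^{2s}yᵗ`, `θ'(t,s,v) = (t, s + t, v)`, half given as a decidable predicate, CM for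
`((2,0),0)`) ⟹ **BAD**: a simple DEGENERATE abelian variety of dimension `8n` with CM by `K` — the doubled type `i(S) ⊔ i(S)·x`,
degenerate because `c = y² ∉ ⟨x²⟩`.
[cite: Kubota1965, §2 and §4 Lemma 2] [cite: Shimura1998, §6.2 Thm. 3 and §8.2 Prop. 26] [cite: Gordon1999HodgeAVSurvey, Thm. 6.4 and §9.3] -/
theorem exists_simple_degenerate_fourSemidirectFour_times_cyclic_ySq_of_half {n : ℕ} [NeZero n]
    (φ : Multiplicative (ZMod 4) →* MulAut (Multiplicative (ZMod 4))) (hφ : ∀ t, φ (Multiplicative.ofAdd 1) t = t⁻¹)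
    (e : (K ≃ₐ[ℚ] K) ≃* (Multiplicative (ZMod 4) ⋊[φ] Multiplicative (ZMod 4)) × Multiplicative (ZMod n))
    (hc : e ((IsCMField.complexConj K).restrictScalars ℚ) = (SemidirectProduct.inr (Multiplicative.ofAdd 2), 1))
    (P : (ZMod 4 × ZMod 2) × ZMod n → Prop) [DecidablePred P] (hP : ∀ s, P s ↔ ¬ P (((2, 0), 0) + s))
    (haper : ∀ a : (ZMod 4 × ZMod 2) × ZMod n, a ≠ 0 → ∃ s, ¬ (P s ↔ P (a + s)))
    (hasym : ∀ a : (ZMod 4 × ZMod 2) × ZMod n, ∃ s, ¬ (P s ↔ P (a + ((s.1.1, s.1.2 + (s.1.1.val : ZMod 2)), s.2)))) :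
    ∃ (Φ : CMType K) (φ₀ : K →+* ℂ) (X : AbelianVariety ℂ) (ι : 𝓞 K →+* End X)
      (ϑ : K →+* Module.End ℂ (complexBetti X.X 1)),
      IsPrimitive (ℂ ≃+* ℂ) Φ.1 φ₀ ∧ ¬ IsNondegenerate Φ ∧ IsCMTypeRealisation Φ X ι ϑ ∧ X.IsSimple ∧ X.dim = 8 * n ∧
      ∃ m q : ℕ, ∃ y : complexBetti (⨁ fun _ : Fin m => X).X (2 * q), IsRationalClass y ∧
        IsOfHodgeType (⨁ fun _ : Fin m => X).dim (⨁ fun _ : Fin m => X).X (2 * q) q q y ∧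
        y ∉ divisorClassesSpan (⨁ fun _ : Fin m => X).X (⨁ fun _ : Fin m => X).dim q := by
  classical
  haveI : Fintype (Multiplicative (ZMod 4) ⋊[φ] Multiplicative (ZMod 4)) := Fintype.ofEquiv _ SemidirectProduct.equivProd.symm
  have hcard : Fintype.card (Multiplicative (ZMod 4) ⋊[φ] Multiplicative (ZMod 4)) = 16 := by
    rw [Fintype.card_congr SemidirectProduct.equivProd, Fintype.card_prod, Fintype.card_multiplicative, ZMod.card]
  -- the action made explicit: `φ(yᵗ) = (·)⁻¹` for `t` odd, `= id` for `t` even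
  have hφ2 : ∀ u, φ (Multiplicative.ofAdd 2) u = u := fun u => by
    rw [show Multiplicative.ofAdd (2 : ZMod 4) = Multiplicative.ofAdd 1 * Multiplicative.ofAdd 1 from rfl, map_mul,
      MulAut.mul_apply, hφ, hφ, inv_inv]
  have hφt : ∀ (t : ZMod 4) (u : Multiplicative (ZMod 4)),
      φ (Multiplicative.ofAdd t) u = if t = 1 ∨ t = 3 then u⁻¹ else u := by
    intro t u
    rcases (by decide : ∀ t : ZMod 4, t = 0 ∨ t = 1 ∨ t = 2 ∨ t = 3) t with rfl | rfl | rfl | rfl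
    · rw [ofAdd_zero, map_one, MulAut.one_apply, if_neg (by decide)]
    · rw [hφ, if_pos (Or.inl rfl)]
    · rw [hφ2, if_neg (by decide)]
    · rw [show Multiplicative.ofAdd (3 : ZMod 4) = Multiplicative.ofAdd 2 * Multiplicative.ofAdd 1 from rfl, map_mul,
        MulAut.mul_apply, hφ, hφ2, if_pos (Or.inr rfl)]
  have hφ' : ∀ (b u : Multiplicative (ZMod 4)),
      φ b u = if Multiplicative.toAdd b = 1 ∨ Multiplicative.toAdd b = 3 then u⁻¹ else u := fun b u => hφt (Multiplicative.toAdd b) u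
  -- the doubling `d : ℤ/2 → ℤ/4`, `d(s) = 2s`
  have hd_add : ∀ s s' : ZMod 2, (2 * ((s + s').val : ZMod 4)) = 2 * (s.val : ZMod 4) + 2 * (s'.val : ZMod 4) := by decide
  have hd_ne : ∀ s : ZMod 2, Multiplicative.ofAdd (2 * (s.val : ZMod 4)) ≠ Multiplicative.ofAdd 1 := by decide
  have hd_inj : ∀ s s' : ZMod 2, (2 * (s.val : ZMod 4)) = 2 * (s'.val : ZMod 4) → s = s' := by decide
  have hφd : ∀ (b : Multiplicative (ZMod 4)) (s : ZMod 2),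
      φ b (Multiplicative.ofAdd (2 * (s.val : ZMod 4))) = Multiplicative.ofAdd (2 * (s.val : ZMod 4)) := by
    intro b s
    rw [hφ']
    have hinv : ∀ s : ZMod 2, (Multiplicative.ofAdd (2 * (s.val : ZMod 4)))⁻¹ = Multiplicative.ofAdd (2 * (s.val : ZMod 4)) := by
      decide
    split_ifs
    · exact hinv s
    · rfl
  have hcomm : ∀ (s : ZMod 2) (b : Multiplicative (ZMod 4)),
      (SemidirectProduct.inr b : Multiplicative (ZMod 4) ⋊[φ] Multiplicative (ZMod 4)) *
        SemidirectProduct.inl (Multiplicative.ofAdd (2 * (s.val : ZMod 4))) =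
        SemidirectProduct.inl (Multiplicative.ofAdd (2 * (s.val : ZMod 4))) * SemidirectProduct.inr b := by
    intro s b
    conv_rhs => rw [← hφd b s, SemidirectProduct.inl_aut, map_inv, inv_mul_cancel_right]
  -- the embedding `i(t, s, v) = (x^{2s} yᵗ, v)` of `A' = ℤ/4 × ℤ/2 × ℤ/n`
  let i₀ : Multiplicative (ZMod 4 × ZMod 2) → Multiplicative (ZMod 4) ⋊[φ] Multiplicative (ZMod 4) := fun w =>
    SemidirectProduct.inl (Multiplicative.ofAdd (2 * ((Multiplicative.toAdd w).2.val : ZMod 4))) *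
      SemidirectProduct.inr (Multiplicative.ofAdd (Multiplicative.toAdd w).1)
  have hi₀_mul : ∀ w w', i₀ (w * w') = i₀ w * i₀ w' := by
    intro w w'
    simp only [i₀, toAdd_mul, Prod.fst_add, Prod.snd_add, hd_add, ofAdd_add, map_mul]
    rw [mul_assoc, mul_assoc, ← mul_assoc (SemidirectProduct.inr _) (SemidirectProduct.inl _), hcomm, mul_assoc]
  let i : Multiplicative (ZMod 4 × ZMod 2) × Multiplicative (ZMod n) →*
      (Multiplicative (ZMod 4) ⋊[φ] Multiplicative (ZMod 4)) × Multiplicative (ZMod n) :=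
    MonoidHom.mk' (fun w => (i₀ w.1, w.2)) fun w w' => by rw [Prod.fst_mul, Prod.snd_mul, hi₀_mul]; rfl
  have hi_apply : ∀ w v, i (w, v) = (i₀ w, v) := fun w v => rfl
  have hi₀_left : ∀ w, (i₀ w).left = Multiplicative.ofAdd (2 * ((Multiplicative.toAdd w).2.val : ZMod 4)) := fun w => by
    simp only [i₀, SemidirectProduct.mul_left, SemidirectProduct.left_inl, SemidirectProduct.right_inl, SemidirectProduct.left_inr,
      map_one, mul_one]
  have hi₀_right : ∀ w, (i₀ w).right = Multiplicative.ofAdd (Multiplicative.toAdd w).1 := fun w => by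
    simp only [i₀, SemidirectProduct.mul_right, SemidirectProduct.right_inl, SemidirectProduct.right_inr, one_mul]
  have hi : Function.Injective i := by
    rintro ⟨w, v⟩ ⟨w', v'⟩ h
    rw [hi_apply, hi_apply, Prod.mk.injEq] at h
    have h1 := congrArg SemidirectProduct.left h.1
    have h2 := congrArg SemidirectProduct.right h.1
    rw [hi₀_left, hi₀_left] at h1
    rw [hi₀_right, hi₀_right] at h2
    refine Prod.ext (Multiplicative.toAdd.injective (Prod.ext (by simpa using h2) (hd_inj _ _ (by simpa using h1)))) h.2
  set x₁ : Multiplicative (ZMod 4) := Multiplicative.ofAdd 1 with hx₁_def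
  set x : (Multiplicative (ZMod 4) ⋊[φ] Multiplicative (ZMod 4)) × Multiplicative (ZMod n) := (SemidirectProduct.inl x₁, 1)
    with hx_def
  have hx : ∀ w, i w ≠ x := fun ⟨w, v⟩ h => by
    have h1 := congrArg (fun z => SemidirectProduct.left z.1) h
    simp only [hi_apply, hx_def, hi₀_left, SemidirectProduct.left_inl] at h1
    exact hd_ne _ h1
  -- `(x^{2s} b) · x = ⟨x^{2s} φ(b)(x), b⟩` in `C₄ ⋊ C₄`
  have hix : ∀ (b : Multiplicative (ZMod 4)) (s : ZMod 2),
      (SemidirectProduct.inl (Multiplicative.ofAdd (2 * (s.val : ZMod 4))) * SemidirectProduct.inr b :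
        Multiplicative (ZMod 4) ⋊[φ] Multiplicative (ZMod 4)) * SemidirectProduct.inl x₁ =
        ⟨Multiplicative.ofAdd (2 * (s.val : ZMod 4)) * φ b x₁, b⟩ := by
    intro b s
    refine SemidirectProduct.ext ?_ ?_
    · simp only [SemidirectProduct.mul_left, SemidirectProduct.mul_right, SemidirectProduct.left_inl, SemidirectProduct.right_inl,
        SemidirectProduct.left_inr, SemidirectProduct.right_inr, map_one, mul_one, one_mul]
    · simp only [SemidirectProduct.mul_right, SemidirectProduct.right_inl, SemidirectProduct.right_inr, one_mul, mul_one]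
  have hcov : ∀ g : (Multiplicative (ZMod 4) ⋊[φ] Multiplicative (ZMod 4)) × Multiplicative (ZMod n),
      (∃ w, g = i w) ∨ (∃ w, g = i w * x) := by
    rintro ⟨⟨a, b⟩, v⟩
    have key : ∀ a b : Multiplicative (ZMod 4), (∃ s : ZMod 2, a = Multiplicative.ofAdd (2 * (s.val : ZMod 4))) ∨
        (∃ s : ZMod 2, a = Multiplicative.ofAdd (2 * (s.val : ZMod 4)) *
          (if Multiplicative.toAdd b = 1 ∨ Multiplicative.toAdd b = 3 then x₁⁻¹ else x₁)) := by
      rw [hx₁_def]; decide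
    obtain ⟨s, hs⟩ | ⟨s, hs⟩ := key a b
    · refine Or.inl ⟨(Multiplicative.ofAdd (Multiplicative.toAdd b, s), v), ?_⟩
      rw [hi_apply, SemidirectProduct.mk_eq_inl_mul_inr, hs]
      simp only [i₀, toAdd_ofAdd, ofAdd_toAdd]
    · refine Or.inr ⟨(Multiplicative.ofAdd (Multiplicative.toAdd b, s), v), ?_⟩
      rw [hi_apply, hx_def, Prod.mk_mul_mk, mul_one]
      refine Prod.ext ?_ rfl
      change (⟨a, b⟩ : Multiplicative (ZMod 4) ⋊[φ] Multiplicative (ZMod 4)) = i₀ _ * SemidirectProduct.inl x₁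
      simp only [i₀, toAdd_ofAdd, ofAdd_toAdd]
      rw [hix, hφ', ← hs]
  -- `θ' = conj_x` on `A'`: `(t, s) ↦ (t, s + t mod 2)`
  let θ₀ : ZMod 4 × ZMod 2 → ZMod 4 × ZMod 2 := fun w => (w.1, w.2 + (w.1.val : ZMod 2))
  have hθ₀_add : ∀ a b, θ₀ (a + b) = θ₀ a + θ₀ b := by decide
  have hθ₀_inv : ∀ a, θ₀ (θ₀ a) = a := by decide
  let θA : ZMod 4 × ZMod 2 ≃+ ZMod 4 × ZMod 2 :=
    { toFun := θ₀, invFun := θ₀, left_inv := hθ₀_inv, right_inv := hθ₀_inv, map_add' := hθ₀_add }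
  let θ : Multiplicative (ZMod 4 × ZMod 2) × Multiplicative (ZMod n) ≃* Multiplicative (ZMod 4 × ZMod 2) × Multiplicative (ZMod n) :=
    MulEquiv.prodCongr θA.toMultiplicative (MulEquiv.refl _)
  have hθ_apply : ∀ w, θ w = (Multiplicative.ofAdd (θ₀ (Multiplicative.toAdd w.1)), w.2) := fun w => rfl
  have hθkey : ∀ (t : ZMod 4) (s : ZMod 2),
      x₁ * Multiplicative.ofAdd (2 * (s.val : ZMod 4)) =
        Multiplicative.ofAdd (2 * ((s + (t.val : ZMod 2)).val : ZMod 4)) * (if t = 1 ∨ t = 3 then x₁⁻¹ else x₁) := by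
    rw [hx₁_def]; decide
  have hθ : ∀ w, x * i w = i (θ w) * x := fun ⟨w, v⟩ => by
    rw [hi_apply, hθ_apply, hi_apply, hx_def, Prod.mk_mul_mk, one_mul, Prod.mk_mul_mk, mul_one]
    refine Prod.ext ?_ rfl
    change SemidirectProduct.inl x₁ * i₀ w = i₀ _ * SemidirectProduct.inl x₁
    simp only [i₀, θ₀, toAdd_ofAdd]
    rw [hix, ← mul_assoc, ← map_mul, ← SemidirectProduct.mk_eq_inl_mul_inr, hφt]
    exact SemidirectProduct.ext (hθkey _ _) rfl
  set q : Multiplicative (ZMod 4 × ZMod 2) × Multiplicative (ZMod n) := (Multiplicative.ofAdd (0, 1), 1) with hq_def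
  have hq : x * x = i q := by
    rw [hx_def, Prod.mk_mul_mk, mul_one, hq_def, hi_apply, ← map_mul]
    refine Prod.ext ?_ rfl
    change SemidirectProduct.inl (x₁ * x₁) = i₀ _
    simp only [i₀, toAdd_ofAdd, ofAdd_zero, map_one, mul_one]
    rfl
  set c : Multiplicative (ZMod 4 × ZMod 2) × Multiplicative (ZMod n) := (Multiplicative.ofAdd (2, 0), 1) with hc_def
  have hic : i c = (SemidirectProduct.inr (Multiplicative.ofAdd 2), 1) := by
    rw [hc_def, hi_apply]
    simp only [i₀, toAdd_ofAdd, ZMod.val_zero, Nat.cast_zero, mul_zero, ofAdd_zero, map_one, one_mul]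
  have hcq : c ∉ Subgroup.zpowers q := by
    rw [Subgroup.mem_zpowers_iff]
    rintro ⟨k, hk⟩
    have h1 := congrArg (fun z => (Multiplicative.toAdd z.1).1) hk
    simp only [hq_def, hc_def, Prod.pow_fst, toAdd_zpow, toAdd_ofAdd, Prod.smul_fst, smul_zero] at h1
    exact absurd h1 (by decide)
  have hcc : c * c = 1 := by
    rw [hc_def, Prod.mk_mul_mk, mul_one, ← ofAdd_add, Prod.mk_add_mk]
    refine Prod.ext ?_ rfl
    change Multiplicative.ofAdd ((2 : ZMod 4) + 2, (0 : ZMod 2) + 0) = 1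
    rw [show (2 : ZMod 4) + 2 = 0 by decide, add_zero]
    rfl
  have hθc : θ c = c := by
    rw [hθ_apply, hc_def]
    refine Prod.ext ?_ rfl
    change Multiplicative.ofAdd (θ₀ (2, 0)) = Multiplicative.ofAdd (2, 0)
    rw [show θ₀ (2, 0) = (2, 0) by decide]
  set S : Finset (Multiplicative (ZMod 4 × ZMod 2) × Multiplicative (ZMod n)) :=
    Finset.univ.filter fun w => P (Multiplicative.toAdd w.1, Multiplicative.toAdd w.2) with hS_def
  have hSmem : ∀ w : Multiplicative (ZMod 4 × ZMod 2) × Multiplicative (ZMod n),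
      w ∈ S ↔ P (Multiplicative.toAdd w.1, Multiplicative.toAdd w.2) := fun w => by simp [hS_def]
  have hS : ∀ a, a ∈ S ↔ c * a ∉ S := fun a => by
    rw [hSmem, hSmem, hc_def, Prod.fst_mul, Prod.snd_mul, one_mul, toAdd_mul, toAdd_ofAdd, hP]
    simp only [Prod.mk_add_mk, zero_add]
  have haper' : ∀ a : Multiplicative (ZMod 4 × ZMod 2) × Multiplicative (ZMod n), a ≠ 1 → ∃ s, ¬ (s ∈ S ↔ a * s ∈ S) := by
    intro a ha
    have ha' : (Multiplicative.toAdd a.1, Multiplicative.toAdd a.2) ≠ (0 : (ZMod 4 × ZMod 2) × ZMod n) := by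
      intro h
      apply ha
      rw [Prod.mk_eq_zero] at h
      exact Prod.ext (toAdd_eq_zero.1 h.1) (toAdd_eq_zero.1 h.2)
    obtain ⟨⟨s₁, s₂⟩, hs⟩ := haper _ ha'
    refine ⟨(Multiplicative.ofAdd s₁, Multiplicative.ofAdd s₂), ?_⟩
    simpa only [hSmem, Prod.fst_mul, Prod.snd_mul, toAdd_mul, toAdd_ofAdd, Prod.mk_add_mk] using hs
  have hasym' : ∀ a : Multiplicative (ZMod 4 × ZMod 2) × Multiplicative (ZMod n), ∃ s, ¬ (s ∈ S ↔ a * θ s ∈ S) := by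
    intro a
    obtain ⟨⟨s₁, s₂⟩, hs⟩ := hasym (Multiplicative.toAdd a.1, Multiplicative.toAdd a.2)
    refine ⟨(Multiplicative.ofAdd s₁, Multiplicative.ofAdd s₂), ?_⟩
    simpa only [hSmem, hθ_apply, θ₀, Prod.fst_mul, Prod.snd_mul, toAdd_mul, toAdd_ofAdd, Prod.mk_add_mk] using hs
  obtain ⟨Φ, φ₀, X, ι, ϑ, h1, h2, h3, h4, h5, h6⟩ := exists_simple_degenerate_of_index_two_doubled e i hi x hx hcov θ hθ q hq hcq
    hcc hθc (by rw [hic]; exact hc) S hS haper' hasym'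
  refine ⟨Φ, φ₀, X, ι, ϑ, h1, h2, h3, h4, ?_, h6⟩
  rw [h5, Fintype.card_prod, hcard, Fintype.card_multiplicative, ZMod.card]
  omega

/-! ## §2 All degrees `n ≥ 3`: `c = y²` -/

/-- **`(C₄ ⋊ C₄) × C_n` with complex conjugation `c = (y², 1)` is BAD for every `n ≥ 3`** — doubled type (over `A' = ⟨y⟩ × ⟨x²⟩`,
`z = x`) of the two-halves fibre half `H₁ = {(0,0),(0,1),(1,0),(1,1)}`, `H₂ = {(0,1),(1,1),(2,0),(3,0)}` over `v = 1`.
[cite: Kubota1965, §2 and §4 Lemma 2] [cite: Shimura1998, §6.2 Thm. 3 and §8.2 Prop. 26] [cite: Gordon1999HodgeAVSurvey, Thm. 6.4 and §9.3] -/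
theorem exists_simple_degenerate_fourSemidirectFour_times_cyclic_ySq {n : ℕ} [NeZero n] (hn : 3 ≤ n)
    (φ : Multiplicative (ZMod 4) →* MulAut (Multiplicative (ZMod 4))) (hφ : ∀ t, φ (Multiplicative.ofAdd 1) t = t⁻¹)
    (e : (K ≃ₐ[ℚ] K) ≃* (Multiplicative (ZMod 4) ⋊[φ] Multiplicative (ZMod 4)) × Multiplicative (ZMod n))
    (hc : e ((IsCMField.complexConj K).restrictScalars ℚ) = (SemidirectProduct.inr (Multiplicative.ofAdd 2), 1)) :
    ∃ (Φ : CMType K) (φ₀ : K →+* ℂ) (X : AbelianVariety ℂ) (ι : 𝓞 K →+* End X)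
      (ϑ : K →+* Module.End ℂ (complexBetti X.X 1)),
      IsPrimitive (ℂ ≃+* ℂ) Φ.1 φ₀ ∧ ¬ IsNondegenerate Φ ∧ IsCMTypeRealisation Φ X ι ϑ ∧ X.IsSimple ∧ X.dim = 8 * n ∧
      ∃ m q : ℕ, ∃ y : complexBetti (⨁ fun _ : Fin m => X).X (2 * q), IsRationalClass y ∧
        IsOfHodgeType (⨁ fun _ : Fin m => X).dim (⨁ fun _ : Fin m => X).X (2 * q) q q y ∧
        y ∉ divisorClassesSpan (⨁ fun _ : Fin m => X).X (⨁ fun _ : Fin m => X).dim q := by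
  classical
  exact exists_simple_degenerate_fourSemidirectFour_times_cyclic_ySq_of_half φ hφ e hc
    (fun s => if s.2 = 1 then s.1 ∈ ({(0,1), (1,1), (2,0), (3,0)} : Finset (ZMod 4 × ZMod 2))
      else s.1 ∈ ({(0,0), (0,1), (1,0), (1,1)} : Finset (ZMod 4 × ZMod 2)))
    (TwoHalves.fibre_cm _ _ (2, 0) (by decide) (by decide))
    (TwoHalves.fibre_aperiodic hn _ _ (by decide) (by decide))
    (TwoHalves.fibre_asymmetric hn (fun w : ZMod 4 × ZMod 2 => (w.1, w.2 + (w.1.val : ZMod 2))) (by decide) _ _ (by decide)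
      (by decide))

/-! ## §3 The complete statement: all three central involutions -/

/-- **`(C₄ ⋊ C₄) × C_n` IS BAD FOR EVERY COMPLEX CONJUGATION IN THE `C₄ ⋊ C₄` FACTOR (`n ≥ 3`).**  `K` a Galois CM field with
`Gal(K/ℚ) ≅ (C₄ ⋊ C₄) × C_n` (`φ(1) = (·)⁻¹`), complex conjugation one of the three central involutions `(x², 1)`, `(x²y², 1)`,
`(y², 1)` ⟹ a SIMPLE DEGENERATE abelian variety of dimension `8n` with CM by `K`, with a rational `(p,p)` class outside the divisor
ring on some power.  (`c ∈ {x², x²y²}`: `CorCM/GaloisFourSemidirectFourTimesCyclicDegenerate`, `A = ⟨x⟩ × ⟨y²⟩`, `z = y`;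
`c = y²`: §2, `A' = ⟨y⟩ × ⟨x²⟩`, `z = x`.)
[cite: Kubota1965, §2 and §4 Lemma 2] [cite: Shimura1998, §6.2 Thm. 3 and §8.2 Prop. 26] [cite: Gordon1999HodgeAVSurvey, Thm. 6.4 and §9.3] -/
theorem exists_simple_degenerate_fourSemidirectFour_times_cyclic_all {n : ℕ} [NeZero n] (hn : 3 ≤ n)
    (φ : Multiplicative (ZMod 4) →* MulAut (Multiplicative (ZMod 4))) (hφ : ∀ t, φ (Multiplicative.ofAdd 1) t = t⁻¹)
    (e : (K ≃ₐ[ℚ] K) ≃* (Multiplicative (ZMod 4) ⋊[φ] Multiplicative (ZMod 4)) × Multiplicative (ZMod n))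
    (hc : e ((IsCMField.complexConj K).restrictScalars ℚ) = (SemidirectProduct.inl (Multiplicative.ofAdd 2), 1) ∨
      e ((IsCMField.complexConj K).restrictScalars ℚ) =
        (SemidirectProduct.inl (Multiplicative.ofAdd 2) * SemidirectProduct.inr (Multiplicative.ofAdd 2), 1) ∨
      e ((IsCMField.complexConj K).restrictScalars ℚ) = (SemidirectProduct.inr (Multiplicative.ofAdd 2), 1)) :
    ∃ (Φ : CMType K) (φ₀ : K →+* ℂ) (X : AbelianVariety ℂ) (ι : 𝓞 K →+* End X)
      (ϑ : K →+* Module.End ℂ (complexBetti X.X 1)),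
      IsPrimitive (ℂ ≃+* ℂ) Φ.1 φ₀ ∧ ¬ IsNondegenerate Φ ∧ IsCMTypeRealisation Φ X ι ϑ ∧ X.IsSimple ∧ X.dim = 8 * n ∧
      ∃ m q : ℕ, ∃ y : complexBetti (⨁ fun _ : Fin m => X).X (2 * q), IsRationalClass y ∧
        IsOfHodgeType (⨁ fun _ : Fin m => X).dim (⨁ fun _ : Fin m => X).X (2 * q) q q y ∧
        y ∉ divisorClassesSpan (⨁ fun _ : Fin m => X).X (⨁ fun _ : Fin m => X).dim q := by
  rcases hc with hc | hc | hc
  · exact exists_simple_degenerate_fourSemidirectFour_times_cyclic_sq hn φ hφ e (Or.inl hc)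
  · exact exists_simple_degenerate_fourSemidirectFour_times_cyclic_sq hn φ hφ e (Or.inr hc)
  · exact exists_simple_degenerate_fourSemidirectFour_times_cyclic_ySq hn φ hφ e hc

end Field

end Summit.HodgeConjecture.CorCM.SplitInvolution

end
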